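import Summits.ResolutionOfSingularities.ResolutionOfSingularities.Theses.Descent
import Summits.ResolutionOfSingularities.ResolutionOfSingularities.Theses.EscapeRate
import Summits.ResolutionOfSingularities.ResolutionOfSingularities.Theses.WildQuotients
import Summits.ResolutionOfSingularities.ResolutionOfSingularities.Theorems.DescentDescentPerfectToAllOfGiraudNormalFormSep
import Summits.ResolutionOfSingularities.ResolutionOfSingularities.Theorems.DescentDescentPerfectToAllOfCleanModels
import Summits.ResolutionOfSingularities.ResolutionOfSingularities.Theorems.RadicialJungCleanModelsOfGiraudNormalFormSep
import Summits.ResolutionOfSingularities.ResolutionOfSingularities.Theorems.RadicialJungCleanModelsReductionAt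
import Summits.ResolutionOfSingularities.ResolutionOfSingularities.Theorems.DescentDescentPerfectToAllOfCleanModelsDimGEFour
import Literature.AlgebraicGeometry.Resolution.KummerNormalForm

/-!
# Crux `DescentPerfectToAll` (stmt-ResolutionOfSingularities-0549) — line `giraud-weak-normal-form`
# (lens-2 «Giraud normal form», planner res-B-lens-2, 2026-08-28; rev 3 by res-B-lens-2 g2)

HONEST FRAMING (KEY-res-B-descent): rung B of LADDER-RESOLUTION; nothing in this file proves
resolution of singularities in characteristic `p`; by `descentPerfectToAll_of_dimGtThree` the content of
the crux lives in `dim ≥ 4`, where NOTHING below is in print.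

## The line (rev 3 — G1 applied; the `dim ≤ 3` regime is no longer a stub of THIS skeleton)
Rev 3 (res-B-lens-2 g2, 2026-08-28) changes only the COMPOSITION: the landed support glue G1
(`Theorems.descentPerfectToAll_of_cleanModelsDimGEFour`, p654205: `CossartPiltant2019 →` `CleanModels`
restricted to `¬ dim W ≤ 3` `→ DescentPerfectToAll`) and the landed POINTWISE reduction
`Theorems.RadicialJung.CleanModels.cleanModelsAt_of_logCleanPrincipalizationAt` let the skeleton theorem
`DescentPerfectToAll_proof` be fed by `stub_cossartPiltant2019` (the tree's NAMED FACT, undischarged, exactly as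
in the PICKED line `via_clean_models.lean` rev 3), `stub_weakNormalFormSep_dimGtThree` (HARDEST, unchanged) and
`stub_looseCleanOfWeakNormalFormAt` (adapter, unchanged).  The rev-2 stub `stub_weakNormalFormSep_dimLeThree`
(whose `dim 2` non-`F`-finite / `dim 3` imperfect-`k` slices are NOT in print — critic caveat C-3) leaves the
0549 skeleton; its statement `GiraudWeakNormalFormSepDimLeThree` stays as a `def` and as a HYPOTHESIS of the
all-dimension corollary `cleanModels_of` (the line still closes 15917 `CleanModels` given both regimes).  New
sorry-free glue: `logCleanPrincipalizationAt_of_weak` (rev 2's global adapter made pointwise in `W`, hence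
dimension-graded) and `cleanModelsDimGEFour_of`.  Rung B is thereby priced, on this line, by
`GiraudWeakNormalFormSepDimGtThree` + the M adapter, modulo Cossart–Piltant — it is NOT paid.

## The line (rev 2 text, kept)
`DescentPerfectToAll ⟸ CleanModels (15917) ⟸ log-clean principalization ⟸ (pointwise adapter) weak Giraud
normal form, split dim ≤ 3 / dim ≥ 4`, through the LANDED, sorry-free edges
`Theorems.descentPerfectToAll_of_cleanModels : RadicialJung.CleanModels → Descent.DescentPerfectToAll`
(p536972; Kato 1994 (10.4) PROVED in tree) and
`Theorems.RadicialJung.CleanModels.cleanModels_of_logCleanPrincipalization` (the 15917 lead's reduction to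
the `L`-free LOOSE statement "the statement Giraud 1983 and Cossart 1987 prove").  Rev 1 of this file went
through item 18001 with a `Strictification` stub (weak ⇒ strict by ≤ `p - 1` rounds of codimension-2
blow-ups); rev 2 observes that the weak-not-strict points `t^p = u·x^A` (`u` a transversal NON-unit,
`A ≢ 0 mod p`) are ALREADY loosely clean of toroidal type with `u` as an extra toric coordinate, so no
blow-up is needed to reach the consumer: the third stub is a pointwise local-algebra lemma and the global
adapter `logCleanPrincipalization_of_weak` is proved here sorry-free (the bookkeeping of
`Theorems.logCleanPrincipalization_of_giraudNormalFormSep`, minus the reindexing).  The line re-cuts the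
research input — it does not restate the crux — into

* the PRINT-SHAPED research statement `GiraudWeakNormalFormSep`: Giraud's conjecture (Bull. SMF 111
  (1983) p. 115: "Il paraît raisonnable d'espérer que, pour tout `X` régulier tel que `Ω¹_X` soit
  localement libre de rang `n` et tout `f ∈ 𝒪_X(X)`, il existe `X' → X` composé d'éclatements à centres
  réguliers tel que `f` satisfasse à (**)") for the CLASS of a purely inseparable degree-`p` extension on a
  separated regular base, with the pointwise conclusion in the format of Giraud's Prop. 1.5 (ii)
  — `a = g^p + u · x^A` with (c-1) `u` a unit and some `A_j` prime to `p`, OR (c-2) `(x, u)`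
  differentially free, rendered derivation-free as `IsWoundOrTransversalAt p x u` — ADAPTED to a global
  snc boundary `E` (`x` = the local equations of the components of `E` through the point; Giraud's `E` is
  `E(f∘π)`, Prop. 1.5 proof p. 114: "`x_i`, `1 ≤ i ≤ m`, est une équation de `E_i`").  This is WEAKER than
  18001's `GiraudNormalFormAt` at exactly one kind of point: (c-2) with `u` a NON-unit and `A ≢ 0 mod p`
  (`a = x²·y`, `p ≠ 2`, boundary `{x = 0}`: Giraud-clean, `J(X, a, E) = 𝒪`, but neither wound-transversal
  with a `p`-th-power monomial nor Kummer along `E`).  Split by dimension into the LITERATURE regime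
  `dim W ≤ 3` (Giraud 1983 Thm. 2.4: `dim 2`, any `F`-finite base; Cossart 1987 / Posva arXiv:2405.05735
  App. A + Claim 5.1.2: `dim 3`, `k = k̄`; gaps: non-`F`-finite `k` in `dim 2`, imperfect `k` in `dim 3`)
  and the OPEN regime `dim W ≥ 4` (Giraud's conjecture proper; `DimensionFourFrontier`);
* the POINTWISE ADAPTER `LooseCleanOfWeakNormalFormAt`: in a regular local domain of characteristic `p`,
  a weak normal form relative to boundary equations `xs_j = ε_j t_j` (units `ε_j`, `t` a minimal generating
  system of `𝔪`) yields a LOOSELY clean representative `c₀^p + c₁^p a` of the `K^p`-line of `a` — the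
  tree's `RadicialJung.CleanModels.stub_looseCleanOfGiraudNormalFormAt` (PROVED for the strict form) with
  one new case: `u ∈ 𝔪 ∖ (𝔪² + (x))`, some `A_j ≢ 0`, where `(x_J, u)` extends to a minimal generating
  system and `u·∏ x_j^{A_j mod p}` is toroidal with all exponents in `(0, p)`.
  (Not registered, recorded in the card: the STRICTIFICATION `weak ⇒ 18001` by ≤ `p - 1` rounds of
  blow-ups of the regular centres `E_j ∩ {u = 0}` — the path that would also close item 18001 for route
  WildQuotients; chart check run by hand in the card.)

## Why this cut (and not 18001 verbatim again)
(1) The named fact `Giraud1983Thm24` (tree) concludes `Giraud15NormalFormAt`, i.e. the WEAK format: it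
discharges the `dim 2`, `F`-finite slice of `stub_weakNormalFormSep_dimLeThree` after an `E`-extraction
adapter, but NOT the corresponding slice of 18001.  (2) The controlling quantity of the weak statement is
first-order and `p`-th-power-blind — Giraud's log-Jacobian content ideal `J(X, f, E)` / Cossart's
`𝒥 = H·J` with `(ν, α)` (Posva 2405.05735 A.1.1, A.1.4: transformation laws, `ν` non-increasing under
permissible blow-ups, invariance under `f ⇝ φ^p f`) — so the residual-order / kangaroo barriers
(`ResidualOrderUnbounded`, HauserPerlega2019) do not quantify over it; the strict format has no such
invariant attached in print.  (3) Relative to the PICKED line `via-clean-models` (stubs = `CleanModels`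
sliced by dimension, pointwise, boundary-free): the weak statement carries the GLOBAL snc boundary `E`,
which is the induction datum of every printed proof (`𝒥(W, a, E)`), i.e. it is the shape in which
`CleanModels_{dim ≥ 4}` would actually be proved (strengthen-to-induct), while the descent to the consumer
is certified here (adapter + landed chain); and it is implied by 18001 (proved below), so it sits
BETWEEN the two registered research statements 18001 ⊒ weak ⊒ log-clean principalization ≡ 15917.

## Stubs (3, rev 3) and composition
`stub_cossartPiltant2019 : CossartPiltant2019` (named fact of the tree, XL, undischarged — shared with the PICKED
line), `stub_weakNormalFormSep_dimGtThree` (HARDEST; research), `stub_looseCleanOfWeakNormalFormAt` (pointwise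
adapter, M); proved here: `logCleanPrincipalizationAt_of_weak` (global adapter, pointwise in `W`),
`logCleanPrincipalization_of_weak` (its all-`W` corollary), `cleanModelsDimGEFour_of` (the `dim ≥ 4` slice of
15917 from the two research-side stubs), the skeleton theorem
`DescentPerfectToAll_proof : Theses.Descent.DescentPerfectToAll` (the item's own decl, from the three stubs by
name, via G1), `DescentPerfectToAll_of` (hypothesis form, concluding the `EscapeRate` copy), `cleanModels_of`
(all dimensions ⇒ 15917 `RadicialJung.CleanModels`, with the `dim ≤ 3` regime as a hypothesis).
SLOT: this file is published by `ledger crux write` + evidence only; the 0549 skeleton slot stays with the lead's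
`via_clean_models` (LINE-FIRST; critic SLOT NOTE 2026-08-28).
Sanity lemmas (sorry-free): `weakNormalFormAt_of_giraudNormalFormAt` (strict ⇒ weak pointwise) and
`giraudWeakNormalFormSep_of_giraudNormalFormSep` (18001 ⇒ the two research stubs), so the research
stubs are provably BELOW 18001.

## Disproof used
`Cruxes/DescentPerfectToAll/Disproof.lean`: every `_false_without_` obstruction there concerns
0549-internal tower / residue-field-level statements (`OneRootRobustAtFixedLevel`, base change along an
inseparable extension); this line base-changes nothing and touches the imperfect field only through the
landed `descentPerfectToAll_of_picover`; no stub is an instance of a landed Negative lemma (the stubs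
quantify over REGULAR bases and assert blow-up models, never resolution of a given singular scheme).
-/

noncomputable section

set_option linter.dupNamespace false

open CategoryTheory AlgebraicGeometry TopologicalSpace IsLocalRing
open Literature.AlgebraicGeometry.Resolution Literature.AlgebraicGeometry.Motives
open Summit.ResolutionOfSingularities.ResolutionOfSingularities.Theorems

namespace Summit.ResolutionOfSingularities.ResolutionOfSingularities.Cruxes.DescentPerfectToAll.GiraudWeakNormalForm

/-- **Giraud's pointwise normal form, boundary-adapted, derivation-free** (Giraud 1983, Prop. 1.5 (ii),
with `E` a free snc boundary instead of `E(f)`): `a = g^p + u · ∏ j, x_j^{A_j}` with EITHER (c-1) `u` a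
unit and some `A_j` prime to `p`, OR (c-2) `u` wound-or-transversal relative to the boundary equations `x`
(`IsWoundOrTransversalAt`: `ū ∉ κ^p`, or `u - c^p ∈ 𝔪 ∖ (𝔪² + (x))` for some `c`) — the derivation-free
rendering of "`(x, u)` differentially free" (for any local ring of characteristic `p` the sequence
`0 → 𝔪/𝔪² → κ ⊗ Ω_{O/ℤ} → Ω_κ → 0` is exact, Matsumura 25.2).  Condition (b) `A_j ≥ 2` of Prop. 1.5 is
dropped (it only records which components belong to `E(f)`).  Compared with the tree's
`GiraudNormalFormAt`: identical except that branch (c-2) does not require the monomial to be a `p`-th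
power. [cite: Giraud1983, Prop. 1.5 (ii)] -/
def WeakNormalFormAt (p : ℕ) {O : Type*} [CommRing O] [IsLocalRing O] {r : ℕ} (x : Fin r → O)
    (a : O) : Prop :=
  ∃ (g u : O) (A : Fin r → ℕ), a = g ^ p + u * ∏ j, x j ^ A j ∧
    ((IsUnit u ∧ ∃ j, ¬ p ∣ A j) ∨ IsWoundOrTransversalAt p x u)

/-- Strict (tree, 18001) ⇒ weak (Giraud) at a point: the wound-transversal branch is the case
`A = p • B`, the Kummer branch is case (c-1). [folklore] -/
theorem weakNormalFormAt_of_giraudNormalFormAt {p : ℕ} {O : Type*} [CommRing O] [IsLocalRing O]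
    {r : ℕ} {x : Fin r → O} {a : O} (h : GiraudNormalFormAt p x a) : WeakNormalFormAt p x a := by
  rcases h with ⟨g, u, B, hu, ha⟩ | ⟨g, A, u, hA, ha⟩
  · refine ⟨g, u, fun j => B j * p, ?_, Or.inr hu⟩
    rw [ha, mul_comm _ u, ← Finset.prod_pow]
    simp_rw [← pow_mul]
  · exact ⟨g, (u : O), A, ha, Or.inl ⟨u.isUnit, hA⟩⟩

/-- **The weak global conclusion** for one base `W` and one extension `L ⊇ K(W)`: a proper birational
`ρ : W' → W` with `W'` integral regular, a global snc boundary `E` on `W'`, and about every point an affine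
neighbourhood `U` with a section `a ∈ Γ(W', U)` representing the class of `L` (`y ∈ L ∖ K(W)`,
`y^p = c`, `ρ^♯ c =` germ of `a`) whose germ at EVERY point of `U` is in `WeakNormalFormAt p x` for the
local equations `x` of the components of `E` through that point — verbatim the conclusion of
`WildQuotients.GiraudNormalFormSep` (item 18001) with `GiraudNormalFormAt` replaced by
`WeakNormalFormAt`. [conjecture] -/
def WeakModel (p : ℕ) (W : Scheme.{0}) [IsIntegral W] (L : Type) [Field L]
    [Algebra W.functionField L] : Prop :=
  ∃ (W' : Scheme.{0}) (_ : IsIntegral W') (ρ : W' ⟶ W) (_ : IsDominant ρ) (E : List W'.IdealSheafData),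
    IsProper ρ ∧ IsBirational ρ ∧ Scheme.IsRegular W' ∧ HasSNC E ∧
    ∀ w' : W', ∃ (U : W'.affineOpens) (hU : w' ∈ (U : W'.Opens))
      (a : W'.presheaf.obj (Opposite.op (U : W'.Opens))),
      (∃ (y : L) (c : W.functionField), y ∉ (algebraMap W.functionField L).range ∧
        y ^ p = algebraMap W.functionField L c ∧
        RatFn.functionFieldMap ρ c =
          algebraMap (W'.presheaf.stalk w') W'.functionField (W'.presheaf.germ (U : W'.Opens) w' hU a)) ∧
      ∀ (w'' : W') (hw'' : w'' ∈ (U : W'.Opens)),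
        ∃ (r : ℕ) (D : Fin r → {D : W'.IdealSheafData // D ∈ E ∧ w'' ∈ D.support})
          (x : Fin r → W'.presheaf.stalk w''), Function.Bijective D ∧
          (∀ j, stalkIdeal (D j).1 w'' = Ideal.span {x j}) ∧
          WeakNormalFormAt p x (W'.presheaf.germ (U : W'.Opens) w'' hw'' a)

/-- **Giraud's conjecture, class version, all dimensions and all fields** (the weak form of item 18001):
for `W` regular integral separated of finite type over a field `k` of characteristic `p` and `L/K(W)`
purely inseparable of degree `p`, a `WeakModel` exists.  Printed: `dim W = 2`, `F`-finite base (Giraud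
1983 Thm. 2.4 + Prop. 1.5); `dim W = 3`, `k = k̄` (Cossart 1987; Posva arXiv:2405.05735 App. A,
Claim 5.1.2).  OPEN: `dim W ≥ 4`; non-`F`-finite `k` (`dim 2`); imperfect `k` (`dim 3`).
[cite: Giraud1983, p. 115 (conjecture)] -/
def GiraudWeakNormalFormSep : Prop :=
  ∀ p : ℕ, p.Prime → ∀ (k : Type) [Field k] [CharP k p] (W : Scheme.{0}) [IsIntegral W]
    (f : W ⟶ Spec (.of k)) (L : Type) [Field L] [Algebra W.functionField L],
    IsSeparated f → LocallyOfFiniteType f → QuasiCompact f → Scheme.IsRegular W →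
    IsPurelyInseparable W.functionField L → Module.finrank W.functionField L = p → WeakModel p W L

/-- The LITERATURE regime `dim W ≤ 3` of `GiraudWeakNormalFormSep`. [cite: Giraud1983, Thm. 2.4] -/
def GiraudWeakNormalFormSepDimLeThree : Prop :=
  ∀ p : ℕ, p.Prime → ∀ (k : Type) [Field k] [CharP k p] (W : Scheme.{0}) [IsIntegral W]
    (f : W ⟶ Spec (.of k)) (L : Type) [Field L] [Algebra W.functionField L],
    IsSeparated f → LocallyOfFiniteType f → QuasiCompact f → Scheme.IsRegular W →
    IsPurelyInseparable W.functionField L → Module.finrank W.functionField L = p →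
    topologicalKrullDim W ≤ 3 → WeakModel p W L

/-- The OPEN regime `dim W ≥ 4` of `GiraudWeakNormalFormSep` — Giraud's conjecture proper; the
dimension range where crux 0549 has content (`descentPerfectToAll_of_dimGtThree`).
[cite: Giraud1983, p. 115 (conjecture)] -/
def GiraudWeakNormalFormSepDimGtThree : Prop :=
  ∀ p : ℕ, p.Prime → ∀ (k : Type) [Field k] [CharP k p] (W : Scheme.{0}) [IsIntegral W]
    (f : W ⟶ Spec (.of k)) (L : Type) [Field L] [Algebra W.functionField L],
    IsSeparated f → LocallyOfFiniteType f → QuasiCompact f → Scheme.IsRegular W →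
    IsPurelyInseparable W.functionField L → Module.finrank W.functionField L = p →
    3 < topologicalKrullDim W → WeakModel p W L

/-- **Log-clean principalization** — verbatim the hypothesis of the 15917 lead's reduction
`Theorems.RadicialJung.CleanModels.cleanModels_of_logCleanPrincipalization`: for `g₀ ∈ K(W) ∖ K(W)^p` on a
regular integral separated `W` of finite type over `k`, a proper birational regular `V → W` on which, at
every point, some non-trivial representative `Σ_{j<p} c_j^p g₀^j` of the `K(W)^p`-line of `g₀` is LOOSELY
clean (toroidal `u ∏ t_i^{a_i}`, all `p ∤ a_i`, `m ≥ 1`; or a unit residually not a `p`-th power; or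
`c^p +` a regular parameter).  Equivalent to `RadicialJung.CleanModels` (15917). [conjecture] -/
def LogCleanPrincipalization : Prop :=
  ∀ (p : ℕ), p.Prime → ∀ (k : Type) [Field k] [CharP k p] (W : Scheme.{0}) [IsIntegral W]
    (f : W ⟶ Spec (.of k)) [IsSeparated f] [LocallyOfFiniteType f] [QuasiCompact f],
    Scheme.IsRegular W → ∀ g₀ : W.functionField, (∀ c : W.functionField, c ^ p ≠ g₀) →
    ∃ (V : Scheme.{0}) (π : V ⟶ W) (_ : IsIntegral V) (_ : IsDominant π),
      IsProper π ∧ IsBirational π ∧ Scheme.IsRegular V ∧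
      ∀ v : V, ∃ c : Fin p → W.functionField, (∃ j : Fin p, (j : ℕ) ≠ 0 ∧ c j ≠ 0) ∧
        ((∃ (d m : ℕ) (hmd : m ≤ d) (t : Fin d → V.presheaf.stalk v) (a : Fin m → ℕ)
            (u : V.presheaf.stalk v), IsUnit u ∧
            Ideal.span (Set.range t) = maximalIdeal (V.presheaf.stalk v) ∧
            ringKrullDim (V.presheaf.stalk v) = (d : WithBot ℕ∞) ∧ 0 < m ∧ (∀ i, ¬ p ∣ a i) ∧
            RatFn.functionFieldMap π (∑ j : Fin p, c j ^ p * g₀ ^ (j : ℕ)) =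
              algebraMap (V.presheaf.stalk v) V.functionField
                (u * ∏ i : Fin m, t (Fin.castLE hmd i) ^ (a i))) ∨
          (∃ u : V.presheaf.stalk v, IsUnit u ∧
            RatFn.functionFieldMap π (∑ j : Fin p, c j ^ p * g₀ ^ (j : ℕ)) =
              algebraMap (V.presheaf.stalk v) V.functionField u ∧
            ∀ c' : V.presheaf.stalk v, u - c' ^ p ∉ maximalIdeal (V.presheaf.stalk v)) ∨
          (∃ s c' : V.presheaf.stalk v,
            RatFn.functionFieldMap π (∑ j : Fin p, c j ^ p * g₀ ^ (j : ℕ)) =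
              algebraMap (V.presheaf.stalk v) V.functionField s ∧
            s - c' ^ p ∈ maximalIdeal (V.presheaf.stalk v) ∧
            s - c' ^ p ∉ maximalIdeal (V.presheaf.stalk v) ^ 2))

/-- **Pointwise adapter: weak normal form ⇒ loose cleanness** (the analogue, for `WeakNormalFormAt`, of
the tree's PROVED `RadicialJung.CleanModels.stub_looseCleanOfGiraudNormalFormAt`, with the boundary
equations given as unit multiples `xs_j = ε_j t_j` of members of a minimal generating system `t` of `𝔪`,
`d = dim O`).  Cases: (c-1) / (c-2)-unit-some-`A_j ≢ 0`: divide by `(∏ x_j^{⌊A_j/p⌋})^p`, toroidal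
`u ∏ x_j^{A_j mod p}`; (c-2), all `p ∣ A_j`: the representative is `u`, wound (`∀ c, u - c^p ∉ 𝔪`, hence a
unit) or transversal (`u - c^p ∈ 𝔪 ∖ 𝔪²` a fortiori); (c-2), `u` a NON-unit, some `A_j ≢ 0` (the
weak-not-strict case): `u ∈ 𝔪 ∖ (𝔪² + (x))`, so `(t_J, u)` extends to a minimal generating system `t'`
and `u ∏ x_j^{A_j mod p} = (unit) ∏ t'_i^{a'_i}` with exponents `A_j mod p` and `1`, all prime to `p`.
[folklore] -/
def LooseCleanOfWeakNormalFormAt : Prop :=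
  ∀ (O K : Type) [CommRing O] [IsRegularLocalRing O] [IsDomain O] [Field K] [Algebra O K]
    [IsFractionRing O K] (p : ℕ), p.Prime → ∀ [CharP O p] (d r : ℕ) (hrd : r ≤ d) (t : Fin d → O),
    Ideal.span (Set.range t) = maximalIdeal O → ringKrullDim O = (d : WithBot ℕ∞) →
    ∀ (ε xs : Fin r → O), (∀ j, IsUnit (ε j)) → (∀ j, xs j = ε j * t (Fin.castLE hrd j)) →
    ∀ a : O, WeakNormalFormAt p xs a →
    ∃ c₀ c₁ : K, c₁ ≠ 0 ∧
      ((∃ (d' m : ℕ) (hmd : m ≤ d') (t' : Fin d' → O) (a' : Fin m → ℕ) (u : O), IsUnit u ∧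
          Ideal.span (Set.range t') = maximalIdeal O ∧
          ringKrullDim O = (d' : WithBot ℕ∞) ∧ 0 < m ∧ (∀ i, ¬ p ∣ a' i) ∧
          c₀ ^ p + c₁ ^ p * algebraMap O K a =
            algebraMap O K (u * ∏ i : Fin m, t' (Fin.castLE hmd i) ^ (a' i))) ∨
        (∃ u : O, IsUnit u ∧ c₀ ^ p + c₁ ^ p * algebraMap O K a = algebraMap O K u ∧
          ∀ c : O, u - c ^ p ∉ maximalIdeal O) ∨
        (∃ s c : O, c₀ ^ p + c₁ ^ p * algebraMap O K a = algebraMap O K s ∧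
          s - c ^ p ∈ maximalIdeal O ∧ s - c ^ p ∉ maximalIdeal O ^ 2))

/-- Dimension split: the two regimes give the all-dimension weak statement. [folklore] -/
theorem giraudWeakNormalFormSep_of_split (h3 : GiraudWeakNormalFormSepDimLeThree)
    (h4 : GiraudWeakNormalFormSepDimGtThree) : GiraudWeakNormalFormSep := by
  intro p hp k _ _ W _ f L _ _ hs hl hq hr hi hd
  by_cases hdim : topologicalKrullDim W ≤ 3
  · exact h3 p hp k W f L hs hl hq hr hi hd hdim
  · exact h4 p hp k W f L hs hl hq hr hi hd (not_le.mp hdim)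

/-- 18001 (strict, all dimensions) ⇒ the weak statement: the research stubs of this line are BELOW item
18001 (pointwise `weakNormalFormAt_of_giraudNormalFormAt`, same model). [folklore] -/
theorem giraudWeakNormalFormSep_of_giraudNormalFormSep
    (hG : Summit.ResolutionOfSingularities.ResolutionOfSingularities.Theses.WildQuotients.GiraudNormalFormSep) :
    GiraudWeakNormalFormSep := by
  intro p hp k _ _ W _ f L _ _ hs hl hq hr hi hd
  obtain ⟨W', hW', ρ, hρ, E, h1, h2, h3, h4, h5⟩ := hG p hp k W f L hs hl hq hr hi hd
  refine ⟨W', hW', ρ, hρ, E, h1, h2, h3, h4, fun w' => ?_⟩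
  obtain ⟨U, hU, a, hrep, hpt⟩ := h5 w'
  refine ⟨U, hU, a, hrep, fun w'' hw'' => ?_⟩
  obtain ⟨r, D, x, hD, hx, hnf⟩ := hpt w'' hw''
  exact ⟨r, D, x, hD, hx, weakNormalFormAt_of_giraudNormalFormAt hnf⟩

/-- 18001 restricted to `dim ≤ 3` gives the first research stub (documentation of the ordering). [folklore] -/
theorem dimLeThree_of_giraudNormalFormSep
    (hG : Summit.ResolutionOfSingularities.ResolutionOfSingularities.Theses.WildQuotients.GiraudNormalFormSep) :
    GiraudWeakNormalFormSepDimLeThree :=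
  fun p hp k _ _ W _ f L _ _ hs hl hq hr hi hd _ =>
    giraudWeakNormalFormSep_of_giraudNormalFormSep hG p hp k W f L hs hl hq hr hi hd

/-- 18001 gives the second research stub likewise. [folklore] -/
theorem dimGtThree_of_giraudNormalFormSep
    (hG : Summit.ResolutionOfSingularities.ResolutionOfSingularities.Theses.WildQuotients.GiraudNormalFormSep) :
    GiraudWeakNormalFormSepDimGtThree :=
  fun p hp k _ _ W _ f L _ _ hs hl hq hr hi hd _ =>
    giraudWeakNormalFormSep_of_giraudNormalFormSep hG p hp k W f L hs hl hq hr hi hd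

/-! ## The registered stubs -/

/-- STUB (named fact of the tree; XL; in print).  **Cossart–Piltant 2019, Thm. 1.1**: resolution of reduced
quasi-excellent schemes of dimension `≤ 3` (`Literature.AlgebraicGeometry.Resolution.CossartPiltant2019`, an
UNDISCHARGED named fact — never cited here as proved in tree).  It enters only through the landed G1
(`descentPerfectToAll_of_cleanModelsDimGEFour`: the `dim W ≤ 3` slice of the degree-`p` residue `DegP_p`), exactly
as in the PICKED line `via_clean_models.lean` rev 3; it replaces rev 2's `stub_weakNormalFormSep_dimLeThree`, whose
non-`F`-finite / imperfect-`k` slices are not in print (critic caveat C-3).  Why it might fail: it does not (it is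
a published theorem); the risk is only the typing debt of the named fact. [cite: CossartPiltant2019, Thm. 1.1] -/
theorem stub_cossartPiltant2019 : CossartPiltant2019.{0} := by
  sorry

/-- STUB (HARDEST; research content, ≥ XL; OPEN in print).  **Giraud's conjecture (1983, p. 115) for the
class of a purely inseparable degree-`p` extension on a separated regular base of dimension `≥ 4`, weak
boundary-adapted form.**  The stub plan (line card): (P1) reach condition (*) — the divisorial zero locus
of `da` (prime divisors `C` with `a ≡ g^p mod I_C^{(2)}` for the best local representative) made an snc
sub-boundary — by Kummer twists / `p`-th-power subtraction along each such `C` (ν_C finite by excellence)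
and embedded resolution of what remains; (P2) principalise Cossart's codimension-`≥ 2` content ideal `J`
(`𝒥(W', a, E) = H·J`) by permissible blow-ups of regular centres in `Sing_ν ∩ E`, using the
transformation law `J' = I_Y^{-α(Y)}·𝒥(…, Y)·𝒪` and `ν` non-increasing (Posva 2405.05735 A.1.4, stated
there for `dim 3`, dimension-free in form).  Why it might fail: at `dim W = 4` the codimension-2
components of `Sing_ν` are surfaces whose regularity / transversality to `E` is not automatic (in `dim 3`
they are regular curves, [Cos87b II.B.2]), and the closed-point game has no printed counterpart
(`DimensionFourFrontier`, base side). [cite: Giraud1983, p. 115 (conjecture)] -/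
theorem stub_weakNormalFormSep_dimGtThree : GiraudWeakNormalFormSepDimGtThree := by
  sorry

/-- STUB (pointwise adapter; M; folklore).  **Weak normal form ⇒ loose cleanness**, see
`LooseCleanOfWeakNormalFormAt`.  Plan: copy the tree proof of
`RadicialJung.CleanModels.stub_looseCleanOfGiraudNormalFormAt` (Frobenius-twist computation
`neg_mul_pow_add_pow_mul_eq`, `rsop_apply_ne_zero`, `exists_enumeration`, unit transport as in
`GiraudNormalFormAt.reindex` / `IsWoundOrTransversalAt.unit_pow_mul`), plus the new case: extend the
linearly independent family `(t̄_J, ū) ⊂ 𝔪/𝔪²` to a minimal generating system (Nakayama;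
`Literature/…/RegularSystemOfParameters.lean`). Why it might fail: only by a typo-level mismatch of formats —
each case is a one-paragraph computation. [folklore] -/
theorem stub_looseCleanOfWeakNormalFormAt : LooseCleanOfWeakNormalFormAt := by
  sorry

/-! ## The global adapter (sorry-free): weak normal form ⇒ log-clean principalization, POINTWISE in `W` -/

/-- **Log-clean principalization from the weak Giraud normal form, for one base `W`** (rev 3: rev 2's
`logCleanPrincipalization_of_weak` made pointwise in `W`, hence dimension-graded), given the pointwise adapter:
the bookkeeping of `Theorems.logCleanPrincipalization_of_giraudNormalFormSep` (radicial extension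
`L = K(W)[T]/(T^p - g₀)` with coordinates, the weak model of `(W, L)` supplied by the hypothesis `hW` — which
carries all the content, so regularity of `W` is not even named —, boundary
equations inside a regular system of parameters by `exists_rsop_extending_of_hasSNC`, pointwise adapter,
coefficients pulled back along `ρ^♯ : K(W) ≅ K(W')`). [folklore] -/
theorem logCleanPrincipalizationAt_of_weak (hS : LooseCleanOfWeakNormalFormAt) (p : ℕ) (hp : p.Prime)
    (k : Type) [Field k] [CharP k p] (W : Scheme.{0}) [IsIntegral W] (f : W ⟶ Spec (.of k))
    [IsSeparated f] [LocallyOfFiniteType f] [QuasiCompact f]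
    (hW : ∀ (L : Type) [Field L] [Algebra W.functionField L],
      IsPurelyInseparable W.functionField L → Module.finrank W.functionField L = p → WeakModel p W L)
    (g₀ : W.functionField) (hg₀ : ∀ c : W.functionField, c ^ p ≠ g₀) :
    ∃ (V : Scheme.{0}) (π : V ⟶ W) (_ : IsIntegral V) (_ : IsDominant π),
      IsProper π ∧ IsBirational π ∧ Scheme.IsRegular V ∧
      ∀ v : V, ∃ c : Fin p → W.functionField, (∃ j : Fin p, (j : ℕ) ≠ 0 ∧ c j ≠ 0) ∧
        ((∃ (d m : ℕ) (hmd : m ≤ d) (t : Fin d → V.presheaf.stalk v) (a : Fin m → ℕ)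
            (u : V.presheaf.stalk v), IsUnit u ∧
            Ideal.span (Set.range t) = maximalIdeal (V.presheaf.stalk v) ∧
            ringKrullDim (V.presheaf.stalk v) = (d : WithBot ℕ∞) ∧ 0 < m ∧ (∀ i, ¬ p ∣ a i) ∧
            RatFn.functionFieldMap π (∑ j : Fin p, c j ^ p * g₀ ^ (j : ℕ)) =
              algebraMap (V.presheaf.stalk v) V.functionField
                (u * ∏ i : Fin m, t (Fin.castLE hmd i) ^ (a i))) ∨
          (∃ u : V.presheaf.stalk v, IsUnit u ∧
            RatFn.functionFieldMap π (∑ j : Fin p, c j ^ p * g₀ ^ (j : ℕ)) =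
              algebraMap (V.presheaf.stalk v) V.functionField u ∧
            ∀ c' : V.presheaf.stalk v, u - c' ^ p ∉ maximalIdeal (V.presheaf.stalk v)) ∨
          (∃ s c' : V.presheaf.stalk v,
            RatFn.functionFieldMap π (∑ j : Fin p, c j ^ p * g₀ ^ (j : ℕ)) =
              algebraMap (V.presheaf.stalk v) V.functionField s ∧
            s - c' ^ p ∈ maximalIdeal (V.presheaf.stalk v) ∧
            s - c' ^ p ∉ maximalIdeal (V.presheaf.stalk v) ^ 2)) := by
  haveI : Fact p.Prime := ⟨hp⟩
  haveI : CharP W.functionField p := RadicialJung.CleanModels.charP_stalk W f _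
  -- the radicial extension `L = K(W)[T]/(T^p - g₀)` with its coordinates
  obtain ⟨L, _instF, _instA, hPI, hdeg, hcoord⟩ :=
    RadicialJung.CleanModels.exists_purelyInseparable_of_forall_pow_ne p hp g₀ hg₀
  -- the weak Giraud model
  obtain ⟨W', hW'int, ρ, hdom, E, hρ, hbir, hW'reg, hE, hNF⟩ :=
    hW L hPI hdeg
  haveI := hW'int
  haveI := hdom
  haveI := hρ
  -- `ρ^♯ : K(W) ≅ K(W')`
  have hbij : Function.Bijective (RatFn.functionFieldMap ρ) := by
    obtain ⟨U, hU, hU', hiso⟩ := hbir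
    haveI := hiso
    exact RatFn.functionFieldMap_bijective_of_isIso_morphismRestrict ρ U hU hU'
  refine ⟨W', ρ, hW'int, hdom, hρ, hbir, hW'reg, fun v => ?_⟩
  -- the uniform weak normal form around `v`, read at `v` itself
  obtain ⟨U, hU, a, ⟨y, c, hy, hyp, hc⟩, hall⟩ := hNF v
  obtain ⟨r, D, xs, hDbij, hDx, hWNF⟩ := hall v hU
  haveI : IsRegularLocalRing (W'.presheaf.stalk v) := hW'reg v
  haveI : CharP (W'.presheaf.stalk v) p := RadicialJung.CleanModels.charP_stalk W' (ρ ≫ f) v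
  -- boundary equations inside a regular system of parameters
  obtain ⟨d, hrd, t, ε, ht, hd, hε, hxε⟩ := exists_rsop_extending_of_hasSNC hE v D hDbij.1 xs hDx
  -- loose cleanness of a representative `c₀^p + c₁^p a` (the pointwise adapter)
  obtain ⟨c₀, c₁, hc₁, htri⟩ :=
    hS (W'.presheaf.stalk v) W'.functionField p hp d r hrd t ht hd ε xs hε hxε
      (W'.presheaf.germ (U : W'.Opens) v hU a) hWNF
  -- coordinates of `y`: `c = Σ e_j^p g₀^j` with some `e_j ≠ 0`, `j ≠ 0`
  obtain ⟨e, hey, hej⟩ := hcoord y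
  have hyr : y ∉ Set.range (algebraMap W.functionField L) := fun h => hy (RingHom.mem_range.mpr h)
  obtain ⟨j₀, hj₀, hej₀⟩ := hej hyr
  have hc_eq : c = ∑ j : Fin p, e j ^ p * g₀ ^ (j : ℕ) :=
    (algebraMap W.functionField L).injective (by rw [hey, hyp])
  -- pull the coefficients back along `ρ^♯`
  obtain ⟨d₀, hd₀⟩ := hbij.2 c₀
  obtain ⟨d₁, hd₁⟩ := hbij.2 c₁
  have hd₁0 : d₁ ≠ 0 := fun h => hc₁ (by rw [← hd₁, h, map_zero])
  let j0 : Fin p := ⟨0, hp.pos⟩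
  let c' : Fin p → W.functionField := fun j => d₁ * e j + if j = j0 then d₀ else 0
  have hsum : ∑ j : Fin p, c' j ^ p * g₀ ^ (j : ℕ) = d₀ ^ p + d₁ ^ p * c := by
    have h1 : ∀ j : Fin p, c' j ^ p * g₀ ^ (j : ℕ) =
        d₁ ^ p * (e j ^ p * g₀ ^ (j : ℕ)) + (if j = j0 then d₀ ^ p * g₀ ^ (j : ℕ) else 0) := by
      intro j
      show (d₁ * e j + if j = j0 then d₀ else 0) ^ p * g₀ ^ (j : ℕ) = _
      rw [add_pow_char, mul_pow]
      split_ifs with h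
      · ring
      · rw [zero_pow hp.ne_zero]; ring
    rw [Finset.sum_congr rfl fun j _ => h1 j, Finset.sum_add_distrib, ← Finset.mul_sum, ← hc_eq,
      Finset.sum_ite_eq' Finset.univ j0, if_pos (Finset.mem_univ _)]
    show d₁ ^ p * c + d₀ ^ p * g₀ ^ (0 : ℕ) = d₀ ^ p + d₁ ^ p * c
    rw [pow_zero, mul_one, add_comm]
  have key : RatFn.functionFieldMap ρ (∑ j : Fin p, c' j ^ p * g₀ ^ (j : ℕ)) =
      c₀ ^ p + c₁ ^ p * algebraMap (W'.presheaf.stalk v) W'.functionField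
        (W'.presheaf.germ (U : W'.Opens) v hU a) := by
    rw [hsum, map_add, map_mul, map_pow, map_pow, hd₀, hd₁, hc]
  refine ⟨c', ⟨j₀, hj₀, ?_⟩, ?_⟩
  · have hne : j₀ ≠ j0 := fun h => hj₀ (by rw [h])
    show d₁ * e j₀ + (if j₀ = j0 then d₀ else 0) ≠ 0
    rw [if_neg hne, add_zero]
    exact mul_ne_zero hd₁0 hej₀
  · rw [key]
    exact htri


/-- All-`W` corollary (rev 2's statement): weak normal form in all dimensions ⇒ `LogCleanPrincipalization`.
[folklore] -/
theorem logCleanPrincipalization_of_weak (hS : LooseCleanOfWeakNormalFormAt)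
    (hW : GiraudWeakNormalFormSep) : LogCleanPrincipalization := by
  intro p hp k _ _ W _ f _ _ _ hWreg g₀ hg₀
  exact logCleanPrincipalizationAt_of_weak hS p hp k W f
    (fun L _ _ hPI hdeg => hW p hp k W f L ‹IsSeparated f› ‹LocallyOfFiniteType f› ‹QuasiCompact f›
      hWreg hPI hdeg) g₀ hg₀

/-! ## The `dim ≥ 4` slice of `CleanModels` (15917) from the research stubs, and the composition via G1 -/

/-- **`CleanModels` restricted to `¬ dim W ≤ 3`** — VERBATIM the hypothesis `h4` of the landed G1
`Theorems.descentPerfectToAll_of_cleanModelsDimGEFour` (= `RadicialJung.CleanModels` with the extra binder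
`¬ topologicalKrullDim W ≤ 3`; = the PICKED line's `stub_cleanModelsDimGEFour`). [conjecture] -/
def CleanModelsDimGEFour : Prop :=
  ∀ p : ℕ, p.Prime → ∀ (k : Type) [Field k] [CharP k p] (W : AlgebraicGeometry.Scheme.{0}) [AlgebraicGeometry.IsIntegral W] (f : W ⟶ AlgebraicGeometry.Spec (.of k)) (L : Type) [Field L] [Algebra W.functionField L], AlgebraicGeometry.IsSeparated f → AlgebraicGeometry.LocallyOfFiniteType f → AlgebraicGeometry.QuasiCompact f → Literature.AlgebraicGeometry.Resolution.Scheme.IsRegular W → IsPurelyInseparable W.functionField L → Module.finrank W.functionField L = p → ¬ topologicalKrullDim W ≤ 3 → ∃ (V : AlgebraicGeometry.Scheme.{0}) (π : V ⟶ W) (_ : AlgebraicGeometry.IsIntegral V) (_ : AlgebraicGeometry.IsDominant π), AlgebraicGeometry.IsProper π ∧ Literature.AlgebraicGeometry.Resolution.IsBirational π ∧ Literature.AlgebraicGeometry.Resolution.Scheme.IsRegular V ∧ (∀ v : V, (∃ (y : L) (g : W.functionField), y ∉ Set.range (algebraMap W.functionField L) ∧ algebraMap W.functionField L g = y ^ p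 ∧ ((∃ (d m : ℕ) (hmd : m ≤ d) (t : Fin d → V.presheaf.stalk v) (a : Fin m → ℕ), Ideal.span (Set.range t) = IsLocalRing.maximalIdeal (V.presheaf.stalk v) ∧ ringKrullDim (V.presheaf.stalk v) = (d : WithBot ℕ∞) ∧ 0 < m ∧ (∀ i, ¬ p ∣ a i) ∧ Literature.AlgebraicGeometry.Motives.RatFn.functionFieldMap π g = ∏ i : Fin m, (algebraMap (V.presheaf.stalk v) V.functionField (t (Fin.castLE hmd i))) ^ (a i)) ∨ (∃ u₀ : V.presheaf.stalk v, IsUnit u₀ ∧ Literature.AlgebraicGeometry.Motives.RatFn.functionFieldMap π g = algebraMap (V.presheaf.stalk v) V.functionField u₀ ∧ ((∀ c : V.presheaf.stalk v, u₀ - c ^ p ∉ IsLocalRing.maximalIdeal (V.presheaf.stalk v)) ∨ (∃ c : V.presheaf.stalk v, u₀ - c ^ p ∈ IsLocalRing.maximalIdeal (V.presheaf.stalk v) ∧ u₀ - c ^ p ∉ IsLocalRing.maximalIdeal (V.presheaf.stalk v) ^ 2))))))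

/-- The `dim ≥ 4` slice of 15917 from the weak normal form in `dim ≥ 4` and the pointwise adapter
(`cleanModelsAt_of_logCleanPrincipalizationAt` ∘ `logCleanPrincipalizationAt_of_weak`). [folklore] -/
theorem cleanModelsDimGEFour_of (hS : LooseCleanOfWeakNormalFormAt)
    (h4 : GiraudWeakNormalFormSepDimGtThree) : CleanModelsDimGEFour := by
  intro p hp k _ _ W _ f L _ _ hsep hloc hqc hWreg hPI hdeg hdim
  haveI := hsep; haveI := hloc; haveI := hqc
  exact RadicialJung.CleanModels.cleanModelsAt_of_logCleanPrincipalizationAt p hp k W f L hPI hdeg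
    (fun g₀ hg₀ => logCleanPrincipalizationAt_of_weak hS p hp k W f
      (fun L' _ _ hPI' hdeg' => h4 p hp k W f L' hsep hloc hqc hWreg hPI' hdeg' (not_le.mp hdim)) g₀ hg₀)

/-- The line also closes crux 15917 (`RadicialJung.CleanModels`) in ALL dimensions, given BOTH regimes of the weak
normal form (the `dim ≤ 3` regime is a hypothesis here, no longer a stub of the 0549 skeleton) and the adapter. [folklore] -/
theorem cleanModels_of (h3 : GiraudWeakNormalFormSepDimLeThree)
    (h4 : GiraudWeakNormalFormSepDimGtThree) (hS : LooseCleanOfWeakNormalFormAt) :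
    Summit.ResolutionOfSingularities.ResolutionOfSingularities.Theses.RadicialJung.CleanModels :=
  RadicialJung.CleanModels.cleanModels_of_logCleanPrincipalization
    (logCleanPrincipalization_of_weak hS (giraudWeakNormalFormSep_of_split h3 h4))

/-! ## Composition, concluding the crux BY NAME -/

/-- **THE SKELETON THEOREM** (`#h21_check_skeleton` shape; slot NOT taken, see header): the item's own decl
`Theses.Descent.DescentPerfectToAll` from the three DECLARED STUBS by name (sorried) — weak Giraud normal form in
`dim ≥ 4` ⇒ (pointwise adapter + the bookkeeping proved above) log-clean principalization of every
`g₀ ∈ K(W) ∖ K(W)^p` on every regular `W` of `dim ≥ 4` ⇒ (`cleanModelsAt_of_logCleanPrincipalizationAt`, landed)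
the `dim ≥ 4` slice of `CleanModels` ⇒ (G1 `descentPerfectToAll_of_cleanModelsDimGEFour`, landed p654205, with the
named fact `CossartPiltant2019` for `dim ≤ 3`) the crux.  No other hypothesis. [folklore] -/
theorem DescentPerfectToAll_proof :
    Summit.ResolutionOfSingularities.ResolutionOfSingularities.Theses.Descent.DescentPerfectToAll :=
  descentPerfectToAll_of_cleanModelsDimGEFour stub_cossartPiltant2019
    (cleanModelsDimGEFour_of stub_looseCleanOfWeakNormalFormAt stub_weakNormalFormSep_dimGtThree)

/-- The same composition with the three stub statements as hypotheses (each hypothesis is literally the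
type of the corresponding `stub_*`), concluding the `EscapeRate` copy of the crux by name. [folklore] -/
theorem DescentPerfectToAll_of (hCP : CossartPiltant2019.{0}) (h4 : GiraudWeakNormalFormSepDimGtThree)
    (hS : LooseCleanOfWeakNormalFormAt) :
    Summit.ResolutionOfSingularities.ResolutionOfSingularities.Theses.EscapeRate.DescentPerfectToAll :=
  escapeRate_descentPerfectToAll_of_cleanModelsDimGEFour hCP (cleanModelsDimGEFour_of hS h4)

/-- Rev-2 composition kept as documentation: with the `dim ≤ 3` regime of the weak normal form as an extra
HYPOTHESIS (not a stub), the crux also follows WITHOUT Cossart–Piltant, through all-dimension `CleanModels`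
(`Theorems.descentPerfectToAll_of_cleanModels`, p536972). [folklore] -/
theorem DescentPerfectToAll_of_allDim (h3 : GiraudWeakNormalFormSepDimLeThree)
    (h4 : GiraudWeakNormalFormSepDimGtThree) (hS : LooseCleanOfWeakNormalFormAt) :
    Summit.ResolutionOfSingularities.ResolutionOfSingularities.Theses.Descent.DescentPerfectToAll :=
  descentPerfectToAll_of_cleanModels (cleanModels_of h3 h4 hS)

end Summit.ResolutionOfSingularities.ResolutionOfSingularities.Cruxes.DescentPerfectToAll.GiraudWeakNormalForm

end
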